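import Summits.QuantumFields.BalabanUV.T4Continuum.Support.CellTaylorPlanting

/-!
# T⁴ programme, spine node NE2 (U1a), sub-row Δ1 «NE2⁰-Dirichlet» — owner item O15-a, leaves (B)+(Bᵗ) «GAUGE-COLUMNS-TWO-LEVEL»,
# file B2: THE DIVERGENCE-PLANTING DEFECT IS AN EXACT DIVERGENCE OF AN INTRA-CELL FLUX (torus lattice calculus)

NE2 formalisation swarm `b2b-balaban-t4-ne2-formalise-*`, LEAF PROVER 05 (gen 9); owner rulings R35 (c) / R36 (a) (journal
`CLAIMS.log` 2026-08-20 l.22128 / l.22328).  File B1 `Support/CellTaylorPlanting` (p239235) gave the cellwise Taylor planting `T` with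
`∂′(Tψ) = JK(∂ψ) + gdef`.  The route to leaf (B) (this seat's NOTES «H⁻¹ route», journal l.⟨next⟩) needs ONE more torus identity: the
«weakly zero» divergence-planting defect `Θu := ∂′ᴴ(JK u) − J₀(∂ᴴu)` (fine divergence of the planted 1-form — face-concentrated — minus the
planted coarse divergence — spread over the cell) is the EXACT fine divergence of an INTRA-CELL flux:

 * §1 `((∂_c)ᴴ v)(z) = Σ_ν conj c·(v(z − e_ν, ν) − v(z, ν))` (`GradOp_conjTranspose_mulVec`); the cell data of `z − e_ν`
   (`par_sub_unitVec_of_zero/_of_pos`, `val_rem_sub_unitVec_of_zero/_of_pos`: the own offset of `z` decides);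
 * §2 **`fluxJ N R M u`**: `(fluxJ u)(x′,ν) = −cJ·(1 − (rem(x′)_ν + 1)/R)·(u(par x′ − e_ν, ν) − u(par x′, ν))` — supported on the intra-cell
   bonds (weight `0` on the face-crossing bonds), and **`GradOp_conjTranspose_JK_sub_JK0_apply`**:
   `((∂′_{R·c})ᴴ(JK u))(z) − (J₀((∂_c)ᴴu))(z) = ((∂′_{R·c})ᴴ(fluxJ u))(z)` for every fine site `z`;
 * §3 the pointwise bound **`norm_fluxJ_le`**: `‖(fluxJ u)(x′,ν)‖ ≤ ‖cJ‖·‖u(par x′ − e_ν, ν) − u(par x′, ν)‖` and the torus sum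
   **`nsq_fluxJ_le`**: `nsq (fluxJ u) ≤ nsq (x ↦ u(x.1 − e_{x.2}, x.2) − u x)` (the own-direction backward difference of `u`; for `u = ∂_cψ`
   this is `‖c‖⁻²·Σ_ν‖∂_νᴴ∂_νψ‖²`, the DIAGONAL discrete Hessian — on a box region the interior one, `DirichletBoxRegularity.Hdiag`).

Consequence used by file B3 (region assembly): `Θu` tested against `G′^{1/2}` costs `‖fluxJ u‖` only (`‖∂′G′∂′ᴴ‖ ≤ 1`), i.e. `n⁻¹·√Hdiag` —
the torus rate, no boundary-layer loss.

HONEST FRAMING (T4-DAG p. 1).  [folklore] lattice calculus on a finite torus, statements and constants OURS; `U = 1`; (B), (Bᵗ) NOT proved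
here; `hinjK` / W3 on boxes OPEN; NE2 (U1a) NOT proved; spine PROVED 0/9 unchanged; NOT [B9] (3.23)–(3.27) as printed; NOT infinite volume /
mass gap / Clay.  HONEST DEPENDENCY: continuum YM on T⁴ ⇐ BetaPertH ∧ nine spine estimates (0/9 proved); BetaPertH ⇐ (D1) ∧ (D4) ∧ CAP+tail;
G-an2-4 gates asym, D1 and NE2/3/4.  No `sorry`.
-/

noncomputable section

open scoped BigOperators ComplexConjugate Matrix
open Finset

namespace Summit.QuantumFields.BalabanUV.T4Continuum.CellDivergencePlanting

open Literature.MathematicalPhysics.QuantumFieldTheory.Balaban1983to89.B5Prop11Plancherel (Tor fine unitVec)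
open Literature.MathematicalPhysics.QuantumFieldTheory.Balaban1983to89.B5Prop11Lower (nsq nsq_nonneg)
open Literature.MathematicalPhysics.QuantumFieldTheory.Balaban1983to89.B5Action121 (sdiff GradOp GradOp_mulVec sdiff_mulVec
  sdiff_conjTranspose_mulVec)
open Literature.MathematicalPhysics.QuantumFieldTheory.Balaban1983to89.B5G183RateTorus (cpt)
open Literature.MathematicalPhysics.QuantumFieldTheory.Balaban1983to89.B5G183RateTorusW (off)
open Summit.QuantumFields.BalabanUV.T4Continuum
open Summit.QuantumFields.BalabanUV.T4Continuum.BalabanAveragedTowerModes (par rem par_cpt_add_off rem_cpt_add_off)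
open Summit.QuantumFields.BalabanUV.T4Continuum.BalabanBlockPoincare (tileEquiv)
open Summit.QuantumFields.BalabanUV.T4Continuum.KingPairingPlantedLaw (JK)
open Summit.QuantumFields.BalabanUV.T4Continuum.BlockPairingGeometry (parT par_add_unitVec)
open Summit.QuantumFields.BalabanUV.T4Continuum.LineAveragingPairing (JK_mulVec)
open Summit.QuantumFields.BalabanUV.T4Continuum.ScalarBlockPlanting (JK0)
open Summit.QuantumFields.BalabanUV.T4Continuum.CellTaylorPlanting (cJ norm_cJ_sq_mul JK0_mulVec val_rem_of_face
  val_rem_add_unitVec_of_face val_rem_add_unitVec_of_not_face sum_fine_eq_sum_tile_real)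

variable {d : ℕ} (N R : ℕ) [NeZero N] [NeZero R] (M : Fin d → ℕ) [hM : ∀ μ, NeZero (M μ)]

/-! ## §1 The adjoint gradient; the cell data of `z − e_ν` -/

/-- **the divergence**: `((∂_c)ᴴ v)(z) = Σ_ν conj c·(v(z − e_ν, ν) − v(z, ν))`. [folklore] -/
theorem GradOp_conjTranspose_mulVec {Nf : Fin d → ℕ} [∀ μ, NeZero (Nf μ)] (c : ℂ) (v : Tor Nf × Fin d → ℂ) (z : Tor Nf) :
    ((GradOp Nf c)ᴴ *ᵥ v) z = ∑ ν, conj c * (v (z - unitVec Nf ν, ν) - v (z, ν)) := by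
  have e : ((GradOp Nf c)ᴴ *ᵥ v) z = ∑ ν, ((sdiff Nf c ν)ᴴ *ᵥ fun x => v (x, ν)) z := by
    simp only [Matrix.mulVec, dotProduct, Matrix.conjTranspose_apply, GradOp]
    rw [Fintype.sum_prod_type, Finset.sum_comm]
  rw [e]
  exact Finset.sum_congr rfl fun ν _ => by rw [sdiff_conjTranspose_mulVec]

/-- the face condition of `z − e_ν` is `rem(z)_ν = 0`: then `par(z − e_ν) = par z − e_ν` … [folklore] -/
theorem par_sub_unitVec_of_zero {ν : Fin d} {z : Tor (fine (R * N) M)} (h0 : (rem N R M z ν : ℕ) = 0) :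
    par N R M (z - unitVec (fine (R * N) M) ν) = par N R M z - unitVec (fine N M) ν := by
  set w := z - unitVec (fine (R * N) M) ν with hw
  have hz : z = w + unitVec (fine (R * N) M) ν := by rw [hw, sub_add_cancel]
  by_cases hf : R ∣ (w ν).val + 1
  · rw [hz, par_add_unitVec, if_pos hf, add_sub_cancel_right]
  · exfalso
    have h := val_rem_add_unitVec_of_not_face N R M hf
    rw [← hz, h0] at h
    omega

/-- … and `rem(z − e_ν)_ν = R − 1`; [folklore] -/
theorem val_rem_sub_unitVec_of_zero {ν : Fin d} {z : Tor (fine (R * N) M)} (h0 : (rem N R M z ν : ℕ) = 0) :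
    (rem N R M (z - unitVec (fine (R * N) M) ν) ν : ℕ) = R - 1 := by
  set w := z - unitVec (fine (R * N) M) ν with hw
  have hz : z = w + unitVec (fine (R * N) M) ν := by rw [hw, sub_add_cancel]
  by_cases hf : R ∣ (w ν).val + 1
  · exact val_rem_of_face N R M hf
  · exfalso
    have h := val_rem_add_unitVec_of_not_face N R M hf
    rw [← hz, h0] at h
    omega

/-- otherwise `par(z − e_ν) = par z` … [folklore] -/
theorem par_sub_unitVec_of_pos {ν : Fin d} {z : Tor (fine (R * N) M)} (h0 : (rem N R M z ν : ℕ) ≠ 0) :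
    par N R M (z - unitVec (fine (R * N) M) ν) = par N R M z := by
  set w := z - unitVec (fine (R * N) M) ν with hw
  have hz : z = w + unitVec (fine (R * N) M) ν := by rw [hw, sub_add_cancel]
  by_cases hf : R ∣ (w ν).val + 1
  · exfalso
    have h := val_rem_add_unitVec_of_face N R M hf
    rw [← hz] at h
    exact h0 h
  · rw [hz, par_add_unitVec, if_neg hf]

/-- … and `rem(z − e_ν)_ν + 1 = rem(z)_ν`. [folklore] -/
theorem val_rem_sub_unitVec_of_pos {ν : Fin d} {z : Tor (fine (R * N) M)} (h0 : (rem N R M z ν : ℕ) ≠ 0) :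
    (rem N R M (z - unitVec (fine (R * N) M) ν) ν : ℕ) + 1 = (rem N R M z ν : ℕ) := by
  set w := z - unitVec (fine (R * N) M) ν with hw
  have hz : z = w + unitVec (fine (R * N) M) ν := by rw [hw, sub_add_cancel]
  by_cases hf : R ∣ (w ν).val + 1
  · exfalso
    have h := val_rem_add_unitVec_of_face N R M hf
    rw [← hz] at h
    exact h0 h
  · have h := val_rem_add_unitVec_of_not_face N R M hf
    rw [← hz] at h
    omega

/-! ## §2 The intra-cell flux and the exact divergence identity -/

/-- the flux weight `fw_ν(x′) = 1 − (rem(x′)_ν + 1)/R` (`= 0` on the far `ν`-face). [folklore] -/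
def fw (x : Tor (fine (R * N) M)) (ν : Fin d) : ℂ := 1 - (((rem N R M x ν : ℕ) : ℂ) + 1) / (R : ℂ)

/-- **THE INTRA-CELL FLUX** of the divergence-planting defect:
`(fluxJ u)(x′,ν) = −cJ·fw_ν(x′)·(u(par x′ − e_ν, ν) − u(par x′, ν))`. [folklore] -/
def fluxJ (u : Tor (fine N M) × Fin d → ℂ) : Tor (fine (R * N) M) × Fin d → ℂ := fun b =>
  -(cJ d R * fw N R M b.1 b.2 * (u (par N R M b.1 - unitVec (fine N M) b.2, b.2) - u (par N R M b.1, b.2)))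

omit [NeZero N] hM in
/-- `‖fw_ν(x′)‖ ≤ 1`. [folklore] -/
theorem norm_fw_le_one (x : Tor (fine (R * N) M)) (ν : Fin d) : ‖fw N R M x ν‖ ≤ 1 := by
  have hR : (0 : ℝ) < R := Nat.cast_pos.mpr (Nat.pos_of_ne_zero (NeZero.ne R))
  have hle : ((rem N R M x ν : ℕ) : ℝ) + 1 ≤ R := by exact_mod_cast (rem N R M x ν).isLt
  have e : fw N R M x ν = (((1 - (((rem N R M x ν : ℕ) : ℝ) + 1) / (R : ℝ)) : ℝ) : ℂ) := by
    unfold fw; push_cast; ring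
  rw [e, Complex.norm_real, Real.norm_of_nonneg]
  · have : 0 ≤ (((rem N R M x ν : ℕ) : ℝ) + 1) / (R : ℝ) := by positivity
    linarith
  · rw [sub_nonneg, div_le_one hR]; exact hle

/-- **THE DIVERGENCE-PLANTING DEFECT IS AN EXACT DIVERGENCE**: for every coarse 1-form `u` and fine site `z`,
`((∂′_{R·c})ᴴ(JK u))(z) − (J₀((∂_c)ᴴ u))(z) = ((∂′_{R·c})ᴴ(fluxJ u))(z)` — the fine divergence of King's planted field (concentrated on
the near faces of the cells) minus the planted coarse divergence (spread over the cells) telescopes, cell by cell and direction by direction,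
into the divergence of the intra-cell flux `fluxJ u`. [folklore] -/
theorem GradOp_conjTranspose_JK_sub_JK0_apply (c : ℂ) (u : Tor (fine N M) × Fin d → ℂ) (z : Tor (fine (R * N) M)) :
    ((GradOp (fine (R * N) M) ((R : ℂ) * c))ᴴ *ᵥ (JK N R M *ᵥ u)) z - (JK0 N R M *ᵥ ((GradOp (fine N M) c)ᴴ *ᵥ u)) z
      = ((GradOp (fine (R * N) M) ((R : ℂ) * c))ᴴ *ᵥ fluxJ N R M u) z := by
  have hR : (R : ℂ) ≠ 0 := by exact_mod_cast NeZero.ne R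
  have hRp : 0 < R := Nat.pos_of_ne_zero (NeZero.ne R)
  rw [GradOp_conjTranspose_mulVec, GradOp_conjTranspose_mulVec, JK0_mulVec, GradOp_conjTranspose_mulVec, Finset.mul_sum,
    ← Finset.sum_sub_distrib]
  refine Finset.sum_congr rfl fun ν _ => ?_
  rw [JK_mulVec, JK_mulVec]
  simp only [parT, fluxJ, fw]
  rw [map_mul, Complex.conj_natCast]
  by_cases h0 : (rem N R M z ν : ℕ) = 0
  · -- `z` on the near `ν`-face of its cell: the planted field jumps, the flux behind is zero
    rw [par_sub_unitVec_of_zero N R M h0, val_rem_sub_unitVec_of_zero N R M h0, h0, Nat.cast_pred hRp]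
    unfold cJ
    push_cast
    field_simp
    ring
  · -- inside the cell: no jump, the flux telescopes
    have h1 := val_rem_sub_unitVec_of_pos N R M h0
    rw [par_sub_unitVec_of_pos N R M h0]
    have e : (((rem N R M z ν : ℕ) : ℂ)) = ((rem N R M (z - unitVec (fine (R * N) M) ν) ν : ℕ) : ℂ) + 1 := by
      rw [← h1]; push_cast; ring
    rw [e]
    unfold cJ
    field_simp
    ring

/-! ## §3 The size of the flux -/

omit [NeZero N] hM in
/-- pointwise: `‖(fluxJ u)(x′,ν)‖ ≤ ‖cJ‖·‖u(par x′ − e_ν, ν) − u(par x′, ν)‖`. [folklore] -/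
theorem norm_fluxJ_le (u : Tor (fine N M) × Fin d → ℂ) (b : Tor (fine (R * N) M) × Fin d) :
    ‖fluxJ N R M u b‖ ≤ ‖cJ d R‖ * ‖u (par N R M b.1 - unitVec (fine N M) b.2, b.2) - u (par N R M b.1, b.2)‖ := by
  unfold fluxJ
  rw [norm_neg, norm_mul, norm_mul]
  calc ‖cJ d R‖ * ‖fw N R M b.1 b.2‖ * ‖u (par N R M b.1 - unitVec (fine N M) b.2, b.2) - u (par N R M b.1, b.2)‖
      ≤ ‖cJ d R‖ * 1 * ‖u (par N R M b.1 - unitVec (fine N M) b.2, b.2) - u (par N R M b.1, b.2)‖ := by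
        gcongr; exact norm_fw_le_one N R M b.1 b.2
    _ = _ := by rw [mul_one]

/-- **THE FLUX COSTS ONE OWN-DIRECTION DIFFERENCE OF `u`**: `nsq (fluxJ u) ≤ nsq (b ↦ u(b.1 − e_{b.2}, b.2) − u b)` (for `u = ∂_cψ`,
`‖c‖²` times the right side is the diagonal discrete Hessian `Σ_ν ‖∂_νᴴ∂_νψ‖²`). [folklore] -/
theorem nsq_fluxJ_le (u : Tor (fine N M) × Fin d → ℂ) :
    nsq (fluxJ N R M u) ≤ nsq (fun b : Tor (fine N M) × Fin d => u (b.1 - unitVec (fine N M) b.2, b.2) - u b) := by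
  have hRd : ‖cJ d R‖ ^ 2 * (R : ℝ) ^ d = 1 := norm_cJ_sq_mul (d := d) R
  unfold nsq
  rw [Fintype.sum_prod_type, Fintype.sum_prod_type]
  calc ∑ x, ∑ ν, ‖fluxJ N R M u (x, ν)‖ ^ 2
      ≤ ∑ x, ∑ ν, ‖cJ d R‖ ^ 2 * ‖u (par N R M x - unitVec (fine N M) ν, ν) - u (par N R M x, ν)‖ ^ 2 :=
        Finset.sum_le_sum fun x _ => Finset.sum_le_sum fun ν _ => by
          rw [← mul_pow]; exact pow_le_pow_left₀ (norm_nonneg _) (norm_fluxJ_le N R M u (x, ν)) 2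
    _ = ∑ y : Tor (fine N M), ∑ _j : Fin d → Fin R, ∑ ν, ‖cJ d R‖ ^ 2 * ‖u (y - unitVec (fine N M) ν, ν) - u (y, ν)‖ ^ 2 := by
        rw [sum_fine_eq_sum_tile_real N R M]
        refine Finset.sum_congr rfl fun y _ => Finset.sum_congr rfl fun j _ => ?_
        rw [par_cpt_add_off]
    _ = ∑ y : Tor (fine N M), ∑ ν, ‖u (y - unitVec (fine N M) ν, ν) - u (y, ν)‖ ^ 2 := by
        refine Finset.sum_congr rfl fun y _ => ?_
        rw [Finset.sum_const, Finset.card_univ, Fintype.card_fun, Fintype.card_fin, Fintype.card_fin, nsmul_eq_mul, Nat.cast_pow,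
          Finset.mul_sum]
        refine Finset.sum_congr rfl fun ν _ => ?_
        rw [← mul_assoc, mul_comm ((R : ℝ) ^ d), hRd, one_mul]

end Summit.QuantumFields.BalabanUV.T4Continuum.CellDivergencePlanting

end
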